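import Summits.FinalStateConjecture.FinalStateConjecture.Theorems.EIHFluxBalanceInertialRecessionStubEndgameOracleTightBallistic

/-!
# Stub `stub_oracleOfClusterBalance` of line `SketchCleanExcision`
# (crux `InertialRecession` (E′), `stmt-FinalStateConjecture-17403`, route `EIHFluxBalance`)

**The increment ORACLE(Q) from the integrated cluster balance** (Mathlib-only). The integrated cluster balance bounds the
change of the kinematic energy–momentum of a member set `S` on `[t₁,t₂]` by `ζ₀(t₁) + C₀∫_{t₁}^{t₂} min(r(s),s)^{-3/2} ds` for ANY
continuous positive set-distance minorant `r` (`r(s) ≤ ‖ξᵢ(s) − ξⱼ(s)‖`, `i ∈ S`, `j ∉ S`). When every (member, outsider) pair is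
BALLISTIC on `[t₁,t₂]` (a fixed unit direction `n` with `⟪ξ̇ⱼ − ξ̇ᵢ, n⟫ ≥ W/2 ≥ W_lo/2`) we take the honest set-distance
`r(s) := min_{i∈S, j∉S} ‖ξᵢ(s) − ξⱼ(s)‖` (continuous: a finite minimum of continuous functions; positive: all pairwise distances are
eventually `≥ A₀`). Pointwise `min(r,s)^{-3/2} ≤ s^{-3/2} + Σ_{pairs} ‖ξⱼ − ξᵢ‖^{-3/2}`, and each pair term is majorised by the landed
ballistic majorant (`ballistic_majorant_inner`, integral `≤ 2√2·8/(W√A₀)`), so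
`∫ min(r,s)^{-3/2} ≤ 2t₁^{-1/2} + N²·2√2·8/(W_lo√A₀)` (`integral_pairRadius_le`). Choosing `A₀(Ω, W_lo)` large (pairwise separation
`‖ξᵢ − ξⱼ‖ → ∞`) and then `T₀` late makes `ζ₀(t₁) + C₀∫… ≤ Ω`. The internal-slowness clause of ORACLE(Q) is not used; `Q := 400`.
-/

noncomputable section

set_option linter.dupNamespace false

open Filter Topology Set MeasureTheory intervalIntegral
open scoped Topology BigOperators InnerProductSpace RealInnerProductSpace

namespace Summit.FinalStateConjecture.FinalStateConjecture.Theorems.SublinearIsFree.Oracle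

open Literature.Geometry.Lorentzian
open Summit.FinalStateConjecture.FinalStateConjecture.Theorems.SublinearIsFree.Endgame
open Summit.FinalStateConjecture.FinalStateConjecture.Theorems.SublinearIsFree.Toy

/-! ### The set-distance radius of a family of ballistic pairs -/

/-- The set-distance `s ↦ min_{p ∈ P} ‖ξ_{p.2}(s) − ξ_{p.1}(s)‖` of a nonempty finite family of pairs of continuous centres is
continuous. [folklore] -/
theorem continuous_pairDist {N : ℕ} (ξ : Fin N → ℝ → E3) (hξ : ∀ i, Continuous (ξ i)) (P : Finset (Fin N × Fin N))
    (hP : P.Nonempty) : Continuous fun s ↦ P.inf' hP fun p ↦ ‖ξ p.2 s - ξ p.1 s‖ :=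
  Continuous.finset_inf'_apply hP fun p _ ↦ ((hξ p.2).sub (hξ p.1)).norm

set_option maxHeartbeats 400000 in
/-- **THE INTEGRAL OF THE SET-DISTANCE RADIUS, BALLISTIC PAIRS.** Let `D` be continuous on `[t₁,t₂]` (`0 < t₁`) and at every
time equal to one of the distances `‖ξ_{p.2} − ξ_{p.1}‖`, `p ∈ P`. If every pair `p ∈ P` is ballistic on `[t₁,t₂]` (unit direction
`n p`, `⟪ξ̇_{p.2} − ξ̇_{p.1}, n p⟫ ≥ W/2 > 0`) and at distance `≥ A₀ > 0`, then
`0 ≤ ∫_{t₁}^{t₂} min(D(s),s)^{-3/2} ds ≤ 2t₁^{-1/2} + |P|·2√2·8/(W√A₀)`. [folklore] -/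
theorem integral_pairRadius_le {N : ℕ} (ξ : Fin N → ℝ → E3) (hξ : ∀ i, ContDiff ℝ 1 (ξ i)) (P : Finset (Fin N × Fin N))
    {D : ℝ → ℝ} {t₁ t₂ W A₀ : ℝ} (ht₁ : 0 < t₁) (h12 : t₁ ≤ t₂) (hW : 0 < W) (hA₀ : 0 < A₀)
    (hDc : ContinuousOn D (Icc t₁ t₂)) (hDP : ∀ s ∈ Icc t₁ t₂, ∃ p ∈ P, D s = ‖ξ p.2 s - ξ p.1 s‖)
    (n : Fin N × Fin N → E3) (hn : ∀ p ∈ P, ‖n p‖ = 1)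
    (hspeed : ∀ p ∈ P, ∀ s ∈ Icc t₁ t₂, W / 2 ≤ ⟪deriv (ξ p.2) s - deriv (ξ p.1) s, n p⟫)
    (hfar : ∀ p ∈ P, ∀ s ∈ Icc t₁ t₂, A₀ ≤ ‖ξ p.2 s - ξ p.1 s‖) :
    0 ≤ ∫ s in t₁..t₂, ((min (D s) s) ^ (3 / 2 : ℝ))⁻¹ ∧
    ∫ s in t₁..t₂, ((min (D s) s) ^ (3 / 2 : ℝ))⁻¹ ≤ 2 * (t₁ ^ (1 / 2 : ℝ))⁻¹ + P.card * (2 * √2 * (8 / (W * √A₀))) := by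
  classical
  -- the ballistic majorants
  set ψ : Fin N × Fin N → ℝ → ℝ := fun p s ↦
    2 * √2 * ((|⟪ξ p.2 s - ξ p.1 s, n p⟫| + A₀) * √(|⟪ξ p.2 s - ξ p.1 s, n p⟫| + A₀))⁻¹
  have hball : ∀ p ∈ P, (∀ s ∈ Icc t₁ t₂, (‖ξ p.2 s - ξ p.1 s‖ * √‖ξ p.2 s - ξ p.1 s‖)⁻¹ ≤ ψ p s) ∧
      ContinuousOn (ψ p) (Icc t₁ t₂) ∧ ∫ s in t₁..t₂, ψ p s ≤ 2 * √2 * (8 / (W * √A₀)) := fun p hp ↦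
    ballistic_majorant_inner (hξ p.1) (hξ p.2) (hn p hp) h12 hW hA₀ (hspeed p hp) (hfar p hp)
  have hψ0 : ∀ p s, 0 ≤ ψ p s := fun p s ↦ by positivity
  have hDpos : ∀ s ∈ Icc t₁ t₂, 0 < D s := fun s hs ↦ by
    obtain ⟨p, hp, hpD⟩ := hDP s hs
    rw [hpD]
    exact hA₀.trans_le (hfar p hp s hs)
  have hmpos : ∀ s ∈ Icc t₁ t₂, 0 < min (D s) s := fun s hs ↦ lt_min (hDpos s hs) (ht₁.trans_le hs.1)
  -- pointwise: `min(D,s)^{-3/2} ≤ s^{-3/2} + Σ ψ_p`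
  have hpt : ∀ s ∈ Icc t₁ t₂, ((min (D s) s) ^ (3 / 2 : ℝ))⁻¹ ≤ (s ^ (3 / 2 : ℝ))⁻¹ + ∑ p ∈ P, ψ p s := by
    intro s hs
    have h1 := inv_rpow_min_le (hDpos s hs) (ht₁.trans_le hs.1)
    obtain ⟨p₀, hp₀, hpD⟩ := hDP s hs
    have h2 : ((D s) ^ (3 / 2 : ℝ))⁻¹ ≤ ∑ p ∈ P, ψ p s := by
      rw [inv_rpow_three_halves (hDpos s hs).le, hpD]
      calc (‖ξ p₀.2 s - ξ p₀.1 s‖ * √‖ξ p₀.2 s - ξ p₀.1 s‖)⁻¹ ≤ ψ p₀ s := (hball p₀ hp₀).1 s hs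
        _ ≤ ∑ p ∈ P, ψ p s := Finset.single_le_sum (fun p _ ↦ hψ0 p s) hp₀
    linarith
  -- continuity / integrability
  have hLcont : ContinuousOn (fun s ↦ ((min (D s) s) ^ (3 / 2 : ℝ))⁻¹) (Icc t₁ t₂) := by
    have hm : ContinuousOn (fun s ↦ min (D s) s) (Icc t₁ t₂) := hDc.inf continuousOn_id
    refine (hm.rpow_const fun s hs ↦ Or.inl (hmpos s hs).ne').inv₀ fun s hs ↦ ?_
    exact (Real.rpow_pos_of_pos (hmpos s hs) _).ne'
  have hR1cont : ContinuousOn (fun s : ℝ ↦ (s ^ (3 / 2 : ℝ))⁻¹) (Icc t₁ t₂) := by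
    refine ContinuousOn.inv₀ ?_ fun s hs ↦ (Real.rpow_pos_of_pos (ht₁.trans_le hs.1) _).ne'
    exact continuousOn_id.rpow_const fun s hs ↦ Or.inl (ht₁.trans_le hs.1).ne'
  have hR2cont : ContinuousOn (fun s ↦ ∑ p ∈ P, ψ p s) (Icc t₁ t₂) :=
    continuousOn_finsetSum _ fun p hp ↦ (hball p hp).2.1
  have hI1 := integral_inv_rpow_three_halves_le ht₁ h12
  have hI2 : ∫ s in t₁..t₂, ∑ p ∈ P, ψ p s ≤ P.card * (2 * √2 * (8 / (W * √A₀))) := by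
    rw [intervalIntegral.integral_finsetSum fun p hp ↦ ((hball p hp).2.1.intervalIntegrable_of_Icc h12)]
    have : ∑ p ∈ P, ∫ s in t₁..t₂, ψ p s ≤ ∑ p ∈ P, 2 * √2 * (8 / (W * √A₀)) :=
      Finset.sum_le_sum fun p hp ↦ (hball p hp).2.2
    rwa [Finset.sum_const, nsmul_eq_mul] at this
  refine ⟨intervalIntegral.integral_nonneg h12 fun s hs ↦ inv_nonneg.mpr (Real.rpow_nonneg (hmpos s hs).le _), ?_⟩
  calc ∫ s in t₁..t₂, ((min (D s) s) ^ (3 / 2 : ℝ))⁻¹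
      ≤ ∫ s in t₁..t₂, ((s ^ (3 / 2 : ℝ))⁻¹ + ∑ p ∈ P, ψ p s) :=
        intervalIntegral.integral_mono_on h12 (hLcont.intervalIntegrable_of_Icc h12)
          ((hR1cont.add hR2cont).intervalIntegrable_of_Icc h12) hpt
    _ = (∫ s in t₁..t₂, (s ^ (3 / 2 : ℝ))⁻¹) + ∫ s in t₁..t₂, ∑ p ∈ P, ψ p s :=
        intervalIntegral.integral_add (hR1cont.intervalIntegrable_of_Icc h12) (hR2cont.intervalIntegrable_of_Icc h12)
    _ ≤ _ := add_le_add hI1 hI2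

/-- **THE SET-DISTANCE RADIUS OF A MEMBER SET WITH BALLISTIC OUTSIDERS.** For a nonempty member set `S` on `[t₁,t₂]` (`0 < t₁`)
whose (member, outsider) pairs are all ballistic with floor `W/2 > 0`, all pairwise distances being `≥ A₀ > 0` on the interval, there
is a continuous positive set-distance minorant `r` (`r(s) ≤ ‖ξᵢ(s) − ξⱼ(s)‖` for `i ∈ S`, `j ∉ S`) with
`0 ≤ ∫_{t₁}^{t₂} min(r(s),s)^{-3/2} ds ≤ 2t₁^{-1/2} + N²·2√2·8/(W√A₀)`: the honest set-distance if `S` has outsiders, `r(s) = s`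
otherwise. [folklore] -/
theorem exists_setRadius {N : ℕ} (ξ : Fin N → ℝ → E3) (hξ : ∀ i, ContDiff ℝ 1 (ξ i)) (S : Finset (Fin N)) (hS : S.Nonempty)
    {t₁ t₂ W A₀ : ℝ} (ht₁ : 0 < t₁) (h12 : t₁ ≤ t₂) (hW : 0 < W) (hA₀ : 0 < A₀)
    (hball : ∀ i ∈ S, ∀ j ∉ S, ∃ n : E3, ‖n‖ = 1 ∧ ∀ s ∈ Icc t₁ t₂, W / 2 ≤ ⟪deriv (ξ j) s - deriv (ξ i) s, n⟫)
    (hfar : ∀ s ∈ Icc t₁ t₂, ∀ i j : Fin N, i ≠ j → A₀ ≤ ‖ξ i s - ξ j s‖) :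
    ∃ r : ℝ → ℝ, ContinuousOn r (Icc t₁ t₂) ∧ (∀ s ∈ Icc t₁ t₂, 0 < r s ∧ ∀ i ∈ S, ∀ j ∉ S, r s ≤ ‖ξ i s - ξ j s‖) ∧
      0 ≤ ∫ s in t₁..t₂, ((min (r s) s) ^ (3 / 2 : ℝ))⁻¹ ∧
      ∫ s in t₁..t₂, ((min (r s) s) ^ (3 / 2 : ℝ))⁻¹ ≤
        2 * (t₁ ^ (1 / 2 : ℝ))⁻¹ + ((N * N : ℕ) : ℝ) * (2 * √2 * (8 / (W * √A₀))) := by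
  classical
  have hK : 0 ≤ 2 * √2 * (8 / (W * √A₀)) := by positivity
  by_cases hSc : Sᶜ.Nonempty
  · -- the pairs (member, outsider)
    have hPne : (S ×ˢ Sᶜ).Nonempty := hS.product hSc
    have hmemP : ∀ p ∈ S ×ˢ Sᶜ, p.1 ∈ S ∧ p.2 ∉ S := fun p hp ↦ by
      have h := Finset.mem_product.1 hp
      exact ⟨h.1, Finset.mem_compl.1 h.2⟩
    have hneP : ∀ p ∈ S ×ˢ Sᶜ, p.2 ≠ p.1 := fun p hp h ↦ by
      obtain ⟨h1, h2⟩ := hmemP p hp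
      rw [h] at h2
      exact h2 h1
    -- the ballistic directions, as a function of the pair
    have hdir : ∀ p : Fin N × Fin N, ∃ m : E3, p ∈ S ×ˢ Sᶜ →
        (‖m‖ = 1 ∧ ∀ s ∈ Icc t₁ t₂, W / 2 ≤ ⟪deriv (ξ p.2) s - deriv (ξ p.1) s, m⟫) := by
      intro p
      by_cases hp : p ∈ S ×ˢ Sᶜ
      · obtain ⟨m, hm⟩ := hball p.1 (hmemP p hp).1 p.2 (hmemP p hp).2
        exact ⟨m, fun _ ↦ hm⟩
      · exact ⟨0, fun h ↦ absurd h hp⟩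
    choose n hn using hdir
    have hfarP : ∀ p ∈ S ×ˢ Sᶜ, ∀ s ∈ Icc t₁ t₂, A₀ ≤ ‖ξ p.2 s - ξ p.1 s‖ := fun p hp s hs ↦
      hfar s hs p.2 p.1 (hneP p hp)
    -- the honest set-distance
    set D : ℝ → ℝ := fun s ↦ (S ×ˢ Sᶜ).inf' hPne fun p ↦ ‖ξ p.2 s - ξ p.1 s‖ with hD
    have hDc : Continuous D := continuous_pairDist ξ (fun i ↦ (hξ i).continuous) (S ×ˢ Sᶜ) hPne
    have hDP : ∀ s ∈ Icc t₁ t₂, ∃ p ∈ S ×ˢ Sᶜ, D s = ‖ξ p.2 s - ξ p.1 s‖ := fun s _ ↦ by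
      obtain ⟨p, hp, h⟩ := Finset.exists_mem_eq_inf' hPne (fun p ↦ ‖ξ p.2 s - ξ p.1 s‖)
      exact ⟨p, hp, h⟩
    obtain ⟨hI0, hI⟩ := integral_pairRadius_le ξ hξ (S ×ˢ Sᶜ) ht₁ h12 hW hA₀ hDc.continuousOn hDP n
      (fun p hp ↦ (hn p hp).1) (fun p hp ↦ (hn p hp).2) hfarP
    refine ⟨D, hDc.continuousOn, fun s hs ↦ ⟨?_, fun i hi j hj ↦ ?_⟩, hI0, hI.trans ?_⟩
    · obtain ⟨p, hp, h⟩ := hDP s hs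
      rw [h]
      exact hA₀.trans_le (hfarP p hp s hs)
    · have hij : (i, j) ∈ S ×ˢ Sᶜ := Finset.mem_product.2 ⟨hi, Finset.mem_compl.2 hj⟩
      calc D s ≤ ‖ξ j s - ξ i s‖ := Finset.inf'_le (fun p : Fin N × Fin N ↦ ‖ξ p.2 s - ξ p.1 s‖) hij
        _ = ‖ξ i s - ξ j s‖ := norm_sub_rev _ _
    · have hcard : ((S ×ˢ Sᶜ).card : ℝ) ≤ ((N * N : ℕ) : ℝ) := by
        have h1 : (S ×ˢ Sᶜ).card ≤ N * N := by
          rw [Finset.card_product]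
          exact Nat.mul_le_mul ((Finset.card_le_univ _).trans (by simp)) ((Finset.card_le_univ _).trans (by simp))
        exact_mod_cast h1
      have := mul_le_mul_of_nonneg_right hcard hK
      linarith
  · -- no outsiders: `r s = s`
    have hSc' : Sᶜ = ∅ := Finset.not_nonempty_iff_eq_empty.1 hSc
    refine ⟨fun s ↦ s, continuousOn_id, fun s hs ↦ ⟨ht₁.trans_le hs.1, fun i _ j hj ↦ ?_⟩, ?_, ?_⟩
    · have h : j ∈ Sᶜ := Finset.mem_compl.2 hj
      rw [hSc'] at h
      exact absurd h (Finset.notMem_empty j)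
    · exact intervalIntegral.integral_nonneg h12 fun s hs ↦
        inv_nonneg.mpr (Real.rpow_nonneg (le_min (ht₁.trans_le hs.1).le (ht₁.trans_le hs.1).le) _)
    · simp only [min_self]
      have hK' : 0 ≤ ((N * N : ℕ) : ℝ) * (2 * √2 * (8 / (W * √A₀))) := by positivity
      linarith [integral_inv_rpow_three_halves_le ht₁ h12]

end Summit.FinalStateConjecture.FinalStateConjecture.Theorems.SublinearIsFree.Oracle

/-! ### The registered stub -/

namespace Summit.FinalStateConjecture.FinalStateConjecture.Theorems.SublinearIsFree.Oracle

open scoped BigOperators Topology Manifold Classical MeasureTheory Matrix InnerProductSpace ContDiff ENNReal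
open Filter Set Function TopologicalSpace MeasureTheory Literature.Geometry.Lorentzian

/-- **OR · THE INCREMENT ORACLE from the integrated cluster balance** (registered stub `stub_oracleOfClusterBalance` of line
`SketchCleanExcision`, item `stmt-FinalStateConjecture-17403`; conclusion = r11's ORACLE(Q) verbatim, consumed by the landed
`tendsto_velocity_of_oracle`). `Q := 400`; given `Ω, W_lo > 0` choose `A₀` with `max(C₀,1)·N²·2√2·8/(W_lo√A₀) ≤ Ω/4` and `T₀` so late
that all pairwise distances are `≥ A₀`, `ζ₀ ≤ Ω/2` and `max(C₀,1)·2t₁^{-1/2} ≤ Ω/4`; then feed the set-distance radius of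
`exists_setRadius` to the cluster balance. The internal-slowness clause is not used. [folklore] -/
theorem stub_oracleOfClusterBalance :
    ∀ (N : ℕ) (M : Fin N → ℝ) (ξ v : Fin N → ℝ → E3) (κ : ℝ), (∀ i, 0 < M i) → 0 < κ → κ < 1 → (∀ i, ContDiff ℝ ((⊤ : ℕ∞) : WithTop ℕ∞) (ξ i)) → (∀ i, ∀ᶠ t in atTop, ‖ξ i t‖ ≤ κ ^ 2 * t) → (∀ i j, i ≠ j → Tendsto (fun t ↦ ‖ξ i t - ξ j t‖) atTop atTop) → (∀ i, Continuous (v i)) → (∃ k : ℝ, 0 ≤ k ∧ k < 1 ∧ ∀ i t, ‖v i t‖ ≤ k) → (∀ i, Tendsto (fun t ↦ deriv (ξ i) t - v i t) atTop (𝓝 0)) → (∃ (C₀ T₀ : ℝ) (ζ₀ : ℝ → ℝ), Tendsto ζ₀ atTop (𝓝 0) ∧ ∀ (S : Finset (Fin N)) (t₁ t₂ : ℝ) (r : ℝ → ℝ), T₀ ≤ t₁ → t₁ ≤ t₂ → S.Nonempty → ContinuousOn r (Set.Icc t₁ t₂) → (∀ s ∈ Set.Icc t₁ t₂, 0 < r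 s ∧ ∀ i ∈ S, ∀ j ∉ S, r s ≤ ‖ξ i s - ξ j s‖) → ‖∑ j ∈ S, (M j * (√(1 - ‖v j t₂‖ ^ 2))⁻¹) • v j t₂ - ∑ j ∈ S, (M j * (√(1 - ‖v j t₁‖ ^ 2))⁻¹) • v j t₁‖ ≤ ζ₀ t₁ + C₀ * ∫ s in t₁..t₂, ((min (r s) s) ^ (3 / 2 : ℝ))⁻¹ ∧ |∑ j ∈ S, M j * (√(1 - ‖v j t₂‖ ^ 2))⁻¹ - ∑ j ∈ S, M j * (√(1 - ‖v j t₁‖ ^ 2))⁻¹| ≤ ζ₀ t₁ + C₀ * ∫ s in t₁..t₂, ((min (r s) s) ^ (3 / 2 : ℝ))⁻¹) → ∃ Q : ℝ, 400 ≤ Q ∧ (∀ Ω : ℝ, 0 < Ω → ∀ Wlo : ℝ, 0 < Wlo → ∃ T₀ : ℝ, ∀ (S : Finset (Fin N)) (t₁ t₂ W : ℝ), T₀ ≤ t₁ → t₁ ≤ t₂ → Wlo ≤ W → S.Nonempty → (∀ s ∈ Set.Icc t₁ t₂, ∀ k ∈ S, ∀ l ∈ S, ‖v k s - v l s‖ ≤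 30 * W / Q) → (∀ i ∈ S, ∀ j ∉ S, ∃ n : E3, ‖n‖ = 1 ∧ ∀ s ∈ Set.Icc t₁ t₂, W / 2 ≤ inner ℝ (deriv (ξ j) s - deriv (ξ i) s) n) → ‖∑ j ∈ S, (M j * (√(1 - ‖v j t₂‖ ^ 2))⁻¹) • v j t₂ - ∑ j ∈ S, (M j * (√(1 - ‖v j t₁‖ ^ 2))⁻¹) • v j t₁‖ ≤ Ω ∧ |∑ j ∈ S, M j * (√(1 - ‖v j t₂‖ ^ 2))⁻¹ - ∑ j ∈ S, M j * (√(1 - ‖v j t₁‖ ^ 2))⁻¹| ≤ Ω) := by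
  intro N M ξ v κ _ _ _ hξ _ hsep _ _ _ hbal
  refine ⟨400, le_rfl, fun Ω hΩ Wlo hWlo ↦ ?_⟩
  obtain ⟨C₀, T₀, ζ₀, hζ, hB⟩ := hbal
  have hξ1 : ∀ i, ContDiff ℝ 1 (ξ i) := fun i ↦ (hξ i).of_le (by exact_mod_cast le_top)
  -- the constant `C = max C₀ 1 > 0`
  set C : ℝ := max C₀ 1 with hC
  have hC0 : 0 < C := lt_max_of_lt_right one_pos
  have hC₀C : C₀ ≤ C := le_max_left _ _
  -- choose `B` (and `A₀ := B²`) with `C · N² · 2√2 · 8/(Wlo B) ≤ Ω/4`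
  have hKt : Tendsto (fun B : ℝ ↦ C * (((N * N : ℕ) : ℝ) * (2 * √2 * (8 / (Wlo * B))))) atTop (𝓝 0) := by
    have h : Tendsto (fun B : ℝ ↦ 8 / (Wlo * B)) atTop (𝓝 0) :=
      tendsto_const_nhds.div_atTop (tendsto_id.const_mul_atTop hWlo)
    simpa using ((h.const_mul (2 * √2)).const_mul ((N * N : ℕ) : ℝ)).const_mul C
  obtain ⟨B, hB1, hBΩ⟩ := ((eventually_ge_atTop (1 : ℝ)).and
    (hKt.eventually (eventually_le_nhds (by positivity : (0 : ℝ) < Ω / 4)))).exists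
  have hB0 : 0 < B := one_pos.trans_le hB1
  have hA₀0 : 0 < B ^ 2 := by positivity
  have hsqA : √(B ^ 2) = B := Real.sqrt_sq hB0.le
  -- late times: pairwise distances `≥ B²`, `ζ₀ ≤ Ω/2`, `C·2t^{-1/2} ≤ Ω/4`, and `t ≥ max T₀ 1`
  have hE1 : ∀ᶠ t in atTop, ∀ i j : Fin N, i ≠ j → B ^ 2 ≤ ‖ξ i t - ξ j t‖ := by
    refine eventually_all.2 fun i ↦ eventually_all.2 fun j ↦ ?_
    by_cases hij : i = j
    · exact Eventually.of_forall fun t h ↦ absurd hij h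
    · exact ((hsep i j hij).eventually_ge_atTop (B ^ 2)).mono fun t ht _ ↦ ht
  have hE2 : ∀ᶠ t in atTop, ζ₀ t ≤ Ω / 2 := hζ.eventually (eventually_le_nhds (by positivity))
  have hE3 : ∀ᶠ t : ℝ in atTop, C * (2 * (t ^ (1 / 2 : ℝ))⁻¹) ≤ Ω / 4 := by
    have h : Tendsto (fun t : ℝ ↦ C * (2 * (t ^ (1 / 2 : ℝ))⁻¹)) atTop (𝓝 0) := by
      have h1 := (tendsto_rpow_atTop (by norm_num : (0 : ℝ) < 1 / 2)).inv_tendsto_atTop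
      simpa using (h1.const_mul 2).const_mul C
    exact h.eventually (eventually_le_nhds (by positivity))
  obtain ⟨T, hT⟩ := eventually_atTop.1 ((eventually_ge_atTop (max T₀ 1)).and (hE1.and (hE2.and hE3)))
  refine ⟨T, fun S t₁ t₂ W ht₁ h12 hW hS _ hball ↦ ?_⟩
  obtain ⟨hT1, -, hζ1, hdec⟩ := hT t₁ ht₁
  have hT₀ : T₀ ≤ t₁ := (le_max_left _ _).trans hT1
  have ht₁0 : 0 < t₁ := one_pos.trans_le ((le_max_right _ _).trans hT1)
  have hfar : ∀ s ∈ Icc t₁ t₂, ∀ i j : Fin N, i ≠ j → B ^ 2 ≤ ‖ξ i s - ξ j s‖ := fun s hs ↦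
    (hT s (ht₁.trans hs.1)).2.1
  have hballW : ∀ i ∈ S, ∀ j ∉ S, ∃ n : E3, ‖n‖ = 1 ∧ ∀ s ∈ Icc t₁ t₂,
      Wlo / 2 ≤ ⟪deriv (ξ j) s - deriv (ξ i) s, n⟫ := by
    intro i hi j hj
    obtain ⟨n, hn, h⟩ := hball i hi j hj
    exact ⟨n, hn, fun s hs ↦ (by linarith : Wlo / 2 ≤ W / 2).trans (h s hs)⟩
  obtain ⟨r, hrc, hrp, hI0, hI⟩ := exists_setRadius ξ hξ1 S hS ht₁0 h12 hWlo hA₀0 hballW hfar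
  obtain ⟨hP, hE⟩ := hB S t₁ t₂ r hT₀ h12 hS hrc hrp
  -- the bound `ζ₀(t₁) + C₀ ∫ ≤ Ω`
  have hkey : ζ₀ t₁ + C₀ * ∫ s in t₁..t₂, ((min (r s) s) ^ (3 / 2 : ℝ))⁻¹ ≤ Ω := by
    set I := ∫ s in t₁..t₂, ((min (r s) s) ^ (3 / 2 : ℝ))⁻¹ with hIdef
    have h1 : C₀ * I ≤ C * I := mul_le_mul_of_nonneg_right hC₀C hI0
    have h2 : C * I ≤ C * (2 * (t₁ ^ (1 / 2 : ℝ))⁻¹) + C * (((N * N : ℕ) : ℝ) * (2 * √2 * (8 / (Wlo * √(B ^ 2))))) := by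
      rw [← mul_add]
      exact mul_le_mul_of_nonneg_left hI hC0.le
    rw [hsqA] at h2
    linarith
  exact ⟨hP.trans hkey, hE.trans hkey⟩

end Summit.FinalStateConjecture.FinalStateConjecture.Theorems.SublinearIsFree.Oracle

end
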